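import Literature.AlgebraicGeometry.HodgeTheory.RealSl2BlocksTimesGenericProducts
import Literature.AlgebraicGeometry.Motives.HodgeLieRealPlacesRank
import HarnessLib

/-!
# `A × C` is stably nondegenerate for a carrier `A` of real `𝔰𝔩₂`-block data with `3 dim A < dim 𝔰𝔭_{2 dim C}` and `C` an abelian surface or threefold with `End⁰(C) = ℚ` — the SIZE bound sharpened to `dim hg ≤ 3 dim A` (Hazama 1989 / Moonen–Zarhin 1999 Thm. (3.2)(1); fivefolds (RM threefold) × (Type I(1) surface), `E₁ × E₂ × E₃ × S`)

Family `hodge`, layer `Literature/AlgebraicGeometry/HodgeTheory`. Research context: cell `pub-hodge-ring2`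
(HONEST FRAMING: research route conditional on HC_CM; not a corollary; Q11.4-sentence-2 already refuted in
dim ≥ 3), Literature lane, programme R14 («generic × generic products»), supplement to
`RealSl2BlocksTimesGenericProducts`. UNCONDITIONAL; theorems only, no definition, no named fact; nothing here
uses or asserts HC_CM; no step towards a summit statement.

WHAT. `RealSl2BlocksTimesGenericProducts` proves `IsStablyNondegenerate (A.prod C)` for `A` with real
`𝔰𝔩₂`-block data (`HasRealSl2Blocks A`) and `C` with `finrank_ℚ End⁰(C) = 1`, `dim C ∈ {2, 3}` under
`4 dim A < dim C (2 dim C + 1)`, the SIZE input of the Goursat step being discharged by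
`dim 𝔤₁ ≤ dim Z(End_Hdg(H¹ A)) = 4 dim A` (no use of skewness). Here the bound is sharpened to
`dim 𝔤₁ ≤ 3 dim A` using the polarization (`𝔰𝔭₂ = 𝔰𝔩₂` blockwise, the tree's `trace_blockMat_eq_zero` and
`RealPlaces.assemble_blockMat`), so the product theorem holds under **`3 dim A < dim C (2 dim C + 1)`**:
`dim A ≤ 3` against a generic SURFACE (the FIVEFOLDS (real-multiplication threefold) × (Type I(1) surface) and
`E₁ × E₂ × E₃ × S` of Moonen–Zarhin's dimension-five theorem, clause (4): «Suppose we are not in one of the cases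
(e), (f) or (g). […] In particular, if X has no simple factor of dimension 4 then Hg(X) = Sp_D(V,φ) and
B•(Xⁿ) = D•(Xⁿ) for every n ≥ 1» [corpus: paper:arxiv-math_9901113 p. 2 L1–L7]), `dim A ≤ 6` against a generic
THREEFOLD.

RESULTS. §1 `HodgeStructure.finrank_le_three_mul_card_of_forall_commute_of_skew` (with the tree's
`finrank_traceFree_blocks`, `dim ⊕_t 𝔰𝔩₂ = 3 #T`, file `HodgeLieRealPlacesRank`); §2 `HasRealSl2Blocks.finrank_le_three_mul_dim`;
§3 **`HasRealSl2Blocks.isStablyNondegenerate_prod_of_endRankOne_sharp`** (`3 dim A < dim C (2 dim C + 1)`), mixed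
powers, `B = D`, the Hodge conjecture, isogeny classes; instances `isStablyNondegenerate_rm_prod_surface_of_endRankOne`
(`End⁰(A)` totally real of degree `dim A ≤ 3`, `S` a Type I(1) surface), `isStablyNondegenerate_rm_prod_threefold_of_endRankOne_sharp`
(`dim A ≤ 6`), `isStablyNondegenerate_threeCurves_prod_surface_of_endRankOne` (`E₁ × E₂ × E₃ × S`).

## References
* [MoonenZarhin1999LowDim] B. Moonen, Yu. Zarhin, Math. Ann. 315 (1999) 711–733, Thm. 0.1 (4), the dimension-five
  theorem (4), §3 (3.1), Thm. (3.2)(1) [corpus: paper:arxiv-math_9901113 p. 1–2, 6]. [cite: MoonenZarhin1999LowDim, §3 Thm. (3.2)(1)]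
* [Hazama1989] F. Hazama, Duke Math. J. 58 (1989) 31–37 (= Gordon 7.6.2). [cite: Hazama1989, Thm. (= Gordon 7.6.2)]
* [Hazama1983] F. Hazama, Tôhoku Math. J. 35 (1983), Thm. (1.1), §3 pp. 305–306. [cite: Hazama1983, §3 (pp. 305–306)]
* [Ribet1983] K. A. Ribet, Amer. J. Math. 105 (1983), Thm. 0–1. [cite: Ribet1983, Thm. 0–1]
* [Gordon1999HodgeAVSurvey] B. B. Gordon, App. B of Lewis (1999), Thm. 7.5, Def. 7.6, Thm. 7.6.2. [cite: Gordon1999HodgeAVSurvey, Thm. 7.6.2]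
* [GoodmanWallachGTM255] R. Goodman, N. R. Wallach, GTM 255, §2.1.2. [cite: GoodmanWallachGTM255, §2.1.2]
* [vanGeemen1994HodgeAV] B. van Geemen, LNM 1594 (1994), §2.4, Lemma 3.7. [cite: vanGeemen1994HodgeAV, Lemma 3.7]
-/

noncomputable section

open scoped TensorProduct
open CategoryTheory Module

/-! ### §1 `dim_ℚ 𝔤 ≤ 3 · #blocks` for skew operators commuting with `End_Hdg` -/

namespace Literature.AlgebraicGeometry.Motives

namespace HodgeStructure

open RealPlaces

variable {V : Type} [AddCommGroup V] [Module ℚ V] [Module.Finite ℚ V] {n : ℤ}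

/-- **`dim_ℚ 𝔤 ≤ 3 · #blocks` for a rational space `𝔤` of `ψ`-SKEW operators commuting with `End_Hdg(V)`**, when
REAL `𝔰𝔩₂`-block data are present (odd weight, `End_Hdg` self-adjoint for `ψ`, two-dimensional blocks `T_{σ_t}`
decomposing `V ⊗ ℂ` with bases `b_t`): a `ℚ`-basis of `𝔤` base-changes to a `ℂ`-independent family
(`linearIndependent_end_baseChange_of_linearIndependent`) of block-preserving `ψ_ℂ`-skew operators, and those are
assembled (`RealPlaces.assemble_blockMat`) from TRACE-FREE blocks (`trace_blockMat_eq_zero`: `𝔰𝔭₂ = 𝔰𝔩₂` on each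
block) — Hazama 1983 §3 «`p_i(𝔥) = 𝔰𝔩₂`», `𝔥 ⊆ 𝔰𝔩₂ × ⋯ × 𝔰𝔩₂`. Sharpens
`finrank_le_of_forall_commute_of_isInternal_eigenBlock` (`4 · #blocks`, no skewness used).
[cite: Hazama1983, §3 (pp. 305–306)] [cite: MoonenZarhin1999LowDim, §3 (3.1)] -/
theorem finrank_le_three_mul_card_of_forall_commute_of_skew (H : HodgeStructure V n) (hn : Odd n)
    (ψ : H.Polarization)
    (hself : ∀ a : H.endAlg, LinearMap.IsAdjointPair ψ.form ψ.form (a : Module.End ℚ V) (a : Module.End ℚ V))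
    {T : Type*} [Fintype T] [DecidableEq T] (σ : T → (H.endAlg →+* ℂ))
    (hint : DirectSum.IsInternal fun t => H.eigenBlock (σ t)) (b : ∀ t, Module.Basis (Fin 2) ℂ (H.eigenBlock (σ t)))
    (𝔤 : Submodule ℚ (Module.End ℚ V))
    (hcomm : ∀ Y ∈ 𝔤, ∀ a : H.endAlg, Y * (a : Module.End ℚ V) = (a : Module.End ℚ V) * Y)
    (hskew : ∀ Y ∈ 𝔤, ∀ v w, ψ.form (Y v) w + ψ.form v (Y w) = 0) :
    Module.finrank ℚ 𝔤 ≤ 3 * Fintype.card T := by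
  classical
  -- the trace-free block families and their assembled operators
  set τ : (T → Matrix (Fin 2) (Fin 2) ℂ) →ₗ[ℂ] (T → ℂ) :=
    LinearMap.pi fun t : T => (Matrix.traceLinearMap (Fin 2) ℂ ℂ).comp (LinearMap.proj t) with hτ
  have hτapply : ∀ N t, τ N t = (N t).trace := fun N t => rfl
  set S : Submodule ℂ (Module.End ℂ (ℂ ⊗[ℚ] V)) := (LinearMap.ker τ).map (assemble hint b) with hS
  have hSfin : Module.finrank ℂ S ≤ 3 * Fintype.card T := by
    rw [← finrank_traceFree_blocks ℂ T]
    exact Submodule.finrank_map_le _ _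
  -- a `ℚ`-basis of `𝔤` base-changes to an independent family inside `S`
  set bg := Module.finBasis ℚ 𝔤 with hbg
  have hbli : LinearIndependent ℚ fun i => ((bg i : 𝔤) : Module.End ℚ V) :=
    bg.linearIndependent.map' 𝔤.subtype 𝔤.ker_subtype
  have hli : LinearIndependent ℂ fun i => (((bg i : 𝔤) : Module.End ℚ V)).baseChange ℂ :=
    linearIndependent_end_baseChange_of_linearIndependent ℂ hbli
  have hmem : ∀ i, (((bg i : 𝔤) : Module.End ℚ V)).baseChange ℂ ∈ S := by
    intro i
    set Y := ((bg i : 𝔤) : Module.End ℚ V) with hY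
    have hmaps : ∀ t, Set.MapsTo (Y.baseChange ℂ) (H.eigenBlock (σ t)) (H.eigenBlock (σ t)) :=
      fun t x hx => H.baseChange_apply_mem_eigenBlock_of_forall_commute (σ t) (hcomm _ (bg i).2) hx
    have hskC := ThetaSubalgebra.formBaseChange_add_eq_zero_of_skew ψ (hskew _ (bg i).2)
    rw [hS, Submodule.mem_map]
    refine ⟨blockMat hint b (Y.baseChange ℂ), ?_, assemble_blockMat hint b hmaps⟩
    rw [LinearMap.mem_ker]
    funext t
    rw [hτapply, Pi.zero_apply]
    exact trace_blockMat_eq_zero H hn ψ hself σ hint b hmaps hskC t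
  have hli' : LinearIndependent ℂ fun i => (⟨_, hmem i⟩ : S) :=
    LinearIndependent.of_comp S.subtype (by simpa [Function.comp_def] using hli)
  have h1 : Module.finrank ℚ 𝔤 ≤ Module.finrank ℂ S := by
    have h := hli'.fintype_card_le_finrank
    rwa [Fintype.card_fin] at h
  exact h1.trans hSfin

end HodgeStructure

end Literature.AlgebraicGeometry.Motives

namespace Literature.AlgebraicGeometry.HodgeTheory

open Literature.AlgebraicTopology.SingularHomology
open Literature.AlgebraicGeometry.Motives (IsSmoothProjective AbelianVariety bettiCohomology
  ofRatClassBaseChange ofRatClassBaseChange_tmul HodgeTensorFacts hodgeTensorFacts_holds)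
open Literature.Barriers.HodgeConjecture
open Literature.AlgebraicGeometry.Motives.HodgeStructure
open Literature.AlgebraicGeometry.ComplexMultiplication
open Literature.RepresentationTheory.GeneralLinear
open Literature.NumberTheory.DiophantineGeometry

/-! ### §2 SIZE for carriers, sharpened: `dim 𝔤₁ ≤ 3 dim A` -/

section Size

variable {A : AbelianVariety ℂ}

/-- **SIZE for a carrier of real `𝔰𝔩₂`-block data, sharp form: `dim_ℚ 𝔤₁ ≤ 3 dim A`** for every rational space
`𝔤₁` of `ψ`-skew endomorphisms of `H¹(A; ℚ)` commuting with `End_Hdg(H¹(A))`, for EVERY polarization `ψ` (Hodge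
endomorphisms are automatically `ψ`-self-adjoint, `isAdjointPair_self_of_real_characters`): `dim hg(A) ≤ dim ⊕_τ 𝔰𝔩(V_τ)
= 3 dim A` (Hazama 1983 §3). [cite: Hazama1983, §3 (pp. 305–306)] [cite: MoonenZarhin1999LowDim, §3 (3.1)] -/
theorem HasRealSl2Blocks.finrank_le_three_mul_dim (hA : HasRealSl2Blocks A)
    (ψ : (BettiUniverse.hodge exists_isReal_hodgeModel_holds
      (Motives.AbelianVariety.isSmoothProjective_holds (A := A)) 1).Polarization)
    (𝔤₁ : Submodule ℚ (Module.End ℚ (bettiCohomology A.X 1)))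
    (hcomm : ∀ Y ∈ 𝔤₁, ∀ a : (BettiUniverse.hodge exists_isReal_hodgeModel_holds
        (Motives.AbelianVariety.isSmoothProjective_holds (A := A)) 1).endAlg,
      Y * (a : Module.End ℚ (bettiCohomology A.X 1)) = (a : Module.End ℚ (bettiCohomology A.X 1)) * Y)
    (hskew : ∀ Y ∈ 𝔤₁, ∀ v w, ψ.form (Y v) w + ψ.form v (Y w) = 0) :
    Module.finrank ℚ 𝔤₁ ≤ 3 * A.dim := by
  classical
  obtain ⟨hc, ι, _, _, τ, hreal, hint, h2, b, hb0, hb1, hθ⟩ := hA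
  have hHD : exists_isReal_hodgeModel := exists_isReal_hodgeModel_holds
  have hI : hodgePQ_independent_of_hodgeModel := hodgePQ_independent_of_hodgeModel_holds
  haveI : Module.Finite ℚ (bettiCohomology A.X 1) := finite_bettiCohomology_one A
  have hXA : IsSmoothProjective A.dim A.X := Motives.AbelianVariety.isSmoothProjective_holds
  have hodd : Odd (((1 : ℕ) : ℤ)) := ⟨0, by norm_num⟩
  set Φ := endAlgebraAlgEquivEndAlgOfComm hc hHD hI with hΦ
  have heq : ∀ i, (BettiUniverse.hodge hHD (Motives.AbelianVariety.isSmoothProjective_holds (A := A)) 1).eigenBlock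
      ((τ i).comp Φ.symm.toRingEquiv.toRingHom) =
      ⨅ e : A.endAlgebra, Module.End.eigenspace ((MulOpposite.unop (bettiRep A e)).baseChange ℂ) (τ i e) :=
    fun i => eigenBlock_comp_endAlgebraAlgEquivEndAlgOfComm_symm hc hHD hI (τ i)
  have hreal' : ∀ i, (starRingEnd ℂ).comp ((τ i).comp Φ.symm.toRingEquiv.toRingHom) =
      (τ i).comp Φ.symm.toRingEquiv.toRingHom :=
    fun i => comp_endAlgebraAlgEquivEndAlgOfComm_symm_isReal hc hHD hI (hreal i)
  have hfun : (fun i => (BettiUniverse.hodge hHD (Motives.AbelianVariety.isSmoothProjective_holds (A := A)) 1).eigenBlock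
      ((τ i).comp Φ.symm.toRingEquiv.toRingHom)) = fun i => (⨅ e : A.endAlgebra,
        Module.End.eigenspace ((MulOpposite.unop (bettiRep A e)).baseChange ℂ) (τ i e) : Submodule ℂ _) :=
    funext heq
  have hint' : DirectSum.IsInternal fun i =>
      (BettiUniverse.hodge hHD (Motives.AbelianVariety.isSmoothProjective_holds (A := A)) 1).eigenBlock
        ((τ i).comp Φ.symm.toRingEquiv.toRingHom) := by
    rw [hfun]; exact hint
  have hself := isAdjointPair_self_of_real_characters
    (BettiUniverse.hodge hHD (Motives.AbelianVariety.isSmoothProjective_holds (A := A)) 1) (by norm_num)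
    (BettiUniverse.hodge_isEffective hHD hXA 1) ψ _ hreal' hint'
  let b' : ∀ i, Module.Basis (Fin 2) ℂ
      ((BettiUniverse.hodge hHD (Motives.AbelianVariety.isSmoothProjective_holds (A := A)) 1).eigenBlock
        ((τ i).comp Φ.symm.toRingEquiv.toRingHom)) :=
    fun i => (b i).map (LinearEquiv.ofEq _ _ (heq i).symm)
  have hle := finrank_le_three_mul_card_of_forall_commute_of_skew
    (BettiUniverse.hodge hHD (Motives.AbelianVariety.isSmoothProjective_holds (A := A)) 1) hodd ψ hself _ hint' b'
    𝔤₁ hcomm hskew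
  -- `#blocks = dim A`
  have hcard : Fintype.card ι = A.dim := by
    have h := Module.finrank_eq_card_basis (hint.collectedBasis b)
    rw [Module.finrank_baseChange, finrank_bettiCohomology_one A, Fintype.card_sigma] at h
    simp only [Fintype.card_fin, Finset.sum_const, Finset.card_univ, smul_eq_mul] at h
    omega
  rw [hcard] at hle
  exact hle

end Size

/-! ### §3 `A × C` stably nondegenerate under `3 dim A < dim 𝔰𝔭_{2 dim C}`; instances -/

section Sharp

variable {A C S E₁ E₂ E₃ : AbelianVariety ℂ}

/-- **Hazama 1989 / Moonen–Zarhin Thm. (3.2)(1), PROVED, sharp SIZE: `A × C` is stably nondegenerate** for `A` a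
carrier of real `𝔰𝔩₂`-block data and `C` an abelian surface or threefold with `End⁰(C) = ℚ` whenever
`3 dim A < dim C (2 dim C + 1)`: `dim A ≤ 3` against a surface, `dim A ≤ 6` against a threefold. No binder.
[cite: MoonenZarhin1999LowDim, §3 Thm. (3.2)(1)] [cite: Hazama1989, Thm. (= Gordon 7.6.2)]
[cite: Gordon1999HodgeAVSurvey, Thm. 7.5 (1), Def. 7.6 and Thm. 7.6.2] -/
theorem HasRealSl2Blocks.isStablyNondegenerate_prod_of_endRankOne_sharp (hA : HasRealSl2Blocks A)
    (hCend : Module.finrank ℚ C.endAlgebra = 1) (hCdim : C.dim = 2 ∨ C.dim = 3)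
    (hsmall : 3 * A.dim < C.dim * (2 * C.dim + 1)) : IsStablyNondegenerate (A.prod C) :=
  hA.isStablyNondegenerate_prod_generic
    (fun ψ 𝔤₁ hcomm hskew => lt_of_le_of_lt (hA.finrank_le_three_mul_dim ψ 𝔤₁ hcomm hskew) hsmall) hCend hCdim

/-- **All `A^{M+1} × C^{N+1}` are stably nondegenerate** under the sharp hypothesis (so `B = D` on them).
[cite: MoonenZarhin1999LowDim, §3 (3.1) and Thm. (3.2)(1)] [cite: Gordon1999HodgeAVSurvey, Def. 7.6 and Thm. 7.6.2] -/
theorem HasRealSl2Blocks.isStablyNondegenerate_powSucc_prod_powSucc_of_endRankOne_sharp (hA : HasRealSl2Blocks A)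
    (hCend : Module.finrank ℚ C.endAlgebra = 1) (hCdim : C.dim = 2 ∨ C.dim = 3)
    (hsmall : 3 * A.dim < C.dim * (2 * C.dim + 1)) (M N : ℕ) :
    IsStablyNondegenerate ((A.powSucc M).prod (C.powSucc N)) :=
  (hA.isStablyNondegenerate_prod_of_endRankOne_sharp hCend hCdim hsmall).powSucc_prod_powSucc M N

/-- **`B(A^{M+1} × C^{N+1}) = D(A^{M+1} × C^{N+1})`** under the sharp hypothesis.
[cite: MoonenZarhin1999LowDim, §3 (3.1) and Thm. (3.2)(1)] -/
theorem HasRealSl2Blocks.isDivisorGenerated_powSucc_prod_powSucc_of_endRankOne_sharp (hA : HasRealSl2Blocks A)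
    (hCend : Module.finrank ℚ C.endAlgebra = 1) (hCdim : C.dim = 2 ∨ C.dim = 3)
    (hsmall : 3 * A.dim < C.dim * (2 * C.dim + 1)) (M N : ℕ) :
    IsDivisorGenerated ((A.powSucc M).prod (C.powSucc N)) :=
  (hA.isStablyNondegenerate_powSucc_prod_powSucc_of_endRankOne_sharp hCend hCdim hsmall M N).isDivisorGenerated

/-- **The Hodge conjecture for every `A^{M+1} × C^{N+1}`** under the sharp hypothesis — UNCONDITIONAL.
[cite: MoonenZarhin1999LowDim, §2 condition (D) and §3 Thm. (3.2)(1)] [cite: vanGeemen1994HodgeAV, §2.4] -/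
theorem HasRealSl2Blocks.hodgeConjectureFor_powSucc_prod_powSucc_of_endRankOne_sharp (hA : HasRealSl2Blocks A)
    (hCend : Module.finrank ℚ C.endAlgebra = 1) (hCdim : C.dim = 2 ∨ C.dim = 3)
    (hsmall : 3 * A.dim < C.dim * (2 * C.dim + 1)) (M N : ℕ) :
    HodgeConjectureFor ((A.powSucc M).prod (C.powSucc N)).dim ((A.powSucc M).prod (C.powSucc N)).X :=
  (hA.isStablyNondegenerate_powSucc_prod_powSucc_of_endRankOne_sharp hCend hCdim hsmall M N).hodgeConjectureFor

/-- **The Hodge conjecture for every abelian variety isogenous to some `(A × C)^{N+1}`** under the sharp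
hypothesis. [cite: vanGeemen1994HodgeAV, Lemma 3.7] [cite: MoonenZarhin1999LowDim, §3 Thm. (3.2)(1)] -/
theorem HasRealSl2Blocks.hodgeConjectureFor_of_isIsogenous_powSucc_prod_of_endRankOne_sharp (hA : HasRealSl2Blocks A)
    (hCend : Module.finrank ℚ C.endAlgebra = 1) (hCdim : C.dim = 2 ∨ C.dim = 3)
    (hsmall : 3 * A.dim < C.dim * (2 * C.dim + 1)) {X : AbelianVariety ℂ} {N : ℕ}
    (hX : AbelianVariety.IsIsogenous X ((A.prod C).powSucc N)) : HodgeConjectureFor X.dim X.X :=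
  (hA.isStablyNondegenerate_prod_of_endRankOne_sharp hCend hCdim hsmall).hodgeConjectureFor_of_isIsogenous_powSucc hX

/-- **UNCONDITIONAL: `A × S` is stably nondegenerate for `End⁰(A)` a totally real field of degree `dim A ≤ 3`
(Types I(e₀), `e₀ = dim A`: non-CM elliptic curves, real-multiplication surfaces and THREEFOLDS) and `S` an
abelian surface with `End⁰(S) = ℚ`** — in dimension five these are rows of Moonen–Zarhin's dimension-five
theorem, clause (4) («no simple factor of dimension 4 ⟹ B•(Xⁿ) = D•(Xⁿ)»); `3 · 3 < 10 = dim 𝔰𝔭₄`.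
[cite: MoonenZarhin1999LowDim, Thm. 0.1 (4) and the dimension-five Theorem (4)] [cite: Ribet1983, Thm. 0–1] -/
theorem isStablyNondegenerate_rm_prod_surface_of_endRankOne (hF : IsField A.endAlgebra)
    [NumberField.IsTotallyReal (EndField A hF)] (hdeg : Module.finrank ℚ A.endAlgebra = A.dim) (hA : A.dim ≤ 3)
    (hSend : Module.finrank ℚ S.endAlgebra = 1) (hS : S.dim = 2) : IsStablyNondegenerate (A.prod S) :=
  (hasRealSl2Blocks_of_isTotallyReal A hF hdeg).isStablyNondegenerate_prod_of_endRankOne_sharp hSend (Or.inl hS)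
    (by rw [hS]; omega)

/-- **UNCONDITIONAL: `A × T` is stably nondegenerate for `End⁰(A)` a totally real field of degree `dim A ≤ 6` and
`T` an abelian threefold with `End⁰(T) = ℚ`** (`3 · 6 < 21 = dim 𝔰𝔭₆`).
[cite: MoonenZarhin1999LowDim, §3 Thm. (3.2)(1)] [cite: Ribet1983, Thm. 0–1] -/
theorem isStablyNondegenerate_rm_prod_threefold_of_endRankOne_sharp (hF : IsField A.endAlgebra)
    [NumberField.IsTotallyReal (EndField A hF)] (hdeg : Module.finrank ℚ A.endAlgebra = A.dim) (hA : A.dim ≤ 6)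
    (hTend : Module.finrank ℚ C.endAlgebra = 1) (hT : C.dim = 3) : IsStablyNondegenerate (A.prod C) :=
  (hasRealSl2Blocks_of_isTotallyReal A hF hdeg).isStablyNondegenerate_prod_of_endRankOne_sharp hTend (Or.inr hT)
    (by rw [hT]; omega)

/-- **UNCONDITIONAL: `E₁ × E₂ × E₃ × S` is stably nondegenerate** for three pairwise orthogonal (`Hom = 0`) elliptic
curves with `End⁰(E_i) = ℚ` and an abelian surface `S` with `End⁰(S) = ℚ` — a FIVEFOLD row of Moonen–Zarhin's
dimension-five theorem, clause (4) (`HasRealSl2Blocks.prod₃`: a carrier of dimension `3`, `3 · 3 < 10`).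
[cite: MoonenZarhin1999LowDim, the dimension-five Theorem (4) and §3 Thm. (3.2)(1)] [cite: Hazama1989, Thm. (= Gordon 7.6.2)] -/
theorem isStablyNondegenerate_threeCurves_prod_surface_of_endRankOne
    (h₁ : Module.finrank ℚ E₁.endAlgebra = 1) (hE₁ : E₁.dim = 1) (h₂ : Module.finrank ℚ E₂.endAlgebra = 1)
    (hE₂ : E₂.dim = 1) (h₃ : Module.finrank ℚ E₃.endAlgebra = 1) (hE₃ : E₃.dim = 1)
    (h₁₂ : ∀ f : E₁ ⟶ E₂, f = 0) (h₂₁ : ∀ f : E₂ ⟶ E₁, f = 0) (h₁₃ : ∀ f : E₁ ⟶ E₃, f = 0)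
    (h₃₁ : ∀ f : E₃ ⟶ E₁, f = 0) (h₂₃ : ∀ f : E₂ ⟶ E₃, f = 0) (h₃₂ : ∀ f : E₃ ⟶ E₂, f = 0)
    (hSend : Module.finrank ℚ S.endAlgebra = 1) (hS : S.dim = 2) :
    IsStablyNondegenerate (((E₁.prod E₂).prod E₃).prod S) :=
  (HasRealSl2Blocks.prod₃ (hasRealSl2Blocks_of_finrank_endAlgebra_eq_one E₁ h₁ hE₁)
    (hasRealSl2Blocks_of_finrank_endAlgebra_eq_one E₂ h₂ hE₂) (hasRealSl2Blocks_of_finrank_endAlgebra_eq_one E₃ h₃ hE₃)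
    h₁₂ h₂₁ h₁₃ h₃₁ h₂₃ h₃₂).isStablyNondegenerate_prod_of_endRankOne_sharp hSend (Or.inl hS)
    (by rw [Motives.AbelianVariety.dim_prod, Motives.AbelianVariety.dim_prod, hE₁, hE₂, hE₃, hS]; norm_num)

/-- **The Hodge conjecture for every power of `E₁ × E₂ × E₃ × S`** under the same hypotheses.
[cite: MoonenZarhin1999LowDim, the dimension-five Theorem (4) and §2 condition (D)] [cite: vanGeemen1994HodgeAV, §2.4] -/
theorem hodgeConjectureFor_powSucc_threeCurves_prod_surface_of_endRankOne
    (h₁ : Module.finrank ℚ E₁.endAlgebra = 1) (hE₁ : E₁.dim = 1) (h₂ : Module.finrank ℚ E₂.endAlgebra = 1)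
    (hE₂ : E₂.dim = 1) (h₃ : Module.finrank ℚ E₃.endAlgebra = 1) (hE₃ : E₃.dim = 1)
    (h₁₂ : ∀ f : E₁ ⟶ E₂, f = 0) (h₂₁ : ∀ f : E₂ ⟶ E₁, f = 0) (h₁₃ : ∀ f : E₁ ⟶ E₃, f = 0)
    (h₃₁ : ∀ f : E₃ ⟶ E₁, f = 0) (h₂₃ : ∀ f : E₂ ⟶ E₃, f = 0) (h₃₂ : ∀ f : E₃ ⟶ E₂, f = 0)
    (hSend : Module.finrank ℚ S.endAlgebra = 1) (hS : S.dim = 2) (N : ℕ) :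
    HodgeConjectureFor ((((E₁.prod E₂).prod E₃).prod S).powSucc N).dim ((((E₁.prod E₂).prod E₃).prod S).powSucc N).X :=
  (isStablyNondegenerate_threeCurves_prod_surface_of_endRankOne h₁ hE₁ h₂ hE₂ h₃ hE₃ h₁₂ h₂₁ h₁₃ h₃₁ h₂₃ h₃₂
    hSend hS).hodgeConjectureFor_powSucc N

end Sharp

end Literature.AlgebraicGeometry.HodgeTheory

end
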